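import Literature.Geometry.Lorentzian.FinalEraPackage2
import Literature.Geometry.Lorentzian.BackgroundChartCalculus
import Literature.Geometry.Lorentzian.KerrCollarConvergence
import HarnessLib

/-!
# Stub H_thin `stub_thinnedFlatChart` — restriction and restart of late charts
# (crux `DispersingCapture`, stmt-FinalStateConjecture-17643, line `registered`, skeleton r10; lead prover c6, 2026-08-17)

Route `DissipativeFinalMotions` of the summit `FinalStateConjecture`. Bookkeeping over `Spacetime.IsLateChart`
(`Literature/Geometry/Lorentzian/KerrConvergence.lean`): (i) a late chart into `O` after `T` on a background with
continuous time function is a late chart after any `T₁ ≥ T` (the open embedding of the late region `{t > T}`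
restricts to the open subset `{t > T₁}`; images shrink); (ii) the flat chart `Ψ₀` on `Minkowski.backgroundOn U₀`
restricted to the open set `U₀ ⊓ W` — `Φ₀ y = Ψ₀ y` — is a late chart into `O` after `T₁` on
`Minkowski.backgroundOn (U₀ ⊓ W)`, has the same differential at every point (the inclusion of opens has the
identity as differential), and its deviation from `η` extended by zero has, at points of `U₀ ⊓ W`, the same
derivatives of every order as that of `Ψ₀` (the two extensions agree on the open set `U₀ ⊓ W`).

The restriction part reuses the generic inclusion bookkeeping of
`Literature/Geometry/Lorentzian/KerrCollarConvergence.lean` (`Spacetime.IsLateChart.comp_inclusion`,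
`Spacetime.deviationExtend_comp_inclusion_of_mem`); the chain rule along `Opens.inclusion` is re-derived here
(it is private there).

References: DHRT arXiv:2104.08222, §1 (late charts); J. M. Lee, Introduction to Smooth Manifolds, Prop. 3.9,
Thm. 5.27 (open submanifolds).
-/

set_option linter.dupNamespace false

noncomputable section

open scoped Manifold ContDiff Topology
open Filter Set Function MeasureTheory Literature.Geometry.Lorentzian

namespace Summit.FinalStateConjecture.FinalStateConjecture.Theorems.DissipativeFinalMotions.DispersingCapture

/-- The inclusion `U → V` of open subsets `U ≤ V` of `E4` has identity differential (both inclusions into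
`E4` do, and `val_V ∘ ι = val_U`; Lee 2013, Prop. 3.9). [folklore] -/
theorem thinnedFlatChart_mfderiv_opensInclusion {U V : TopologicalSpace.Opens E4} (h : U ≤ V) (x : U) :
    mfderiv 𝓘(ℝ, E4) 𝓘(ℝ, E4) (TopologicalSpace.Opens.inclusion h) x =
      ContinuousLinearMap.id ℝ E4 := by
  -- adapted from `mfderiv_opensInclusion` (private) in Literature/Geometry/Lorentzian/KerrCollarConvergence.lean
  have hι : MDifferentiableAt 𝓘(ℝ, E4) 𝓘(ℝ, E4) (TopologicalSpace.Opens.inclusion h) x :=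
    (contMDiff_inclusion (n := ∞) h x).mdifferentiableAt (by simp)
  have hc := mfderiv_comp x
    (_root_.Literature.Geometry.Manifold.OpenSubmanifold.hasMFDerivAt_subtype_val
      (I := 𝓘(ℝ, E4)) (TopologicalSpace.Opens.inclusion h x)).mdifferentiableAt hι
  have hval : (Subtype.val : V → E4) ∘ TopologicalSpace.Opens.inclusion h = (Subtype.val : U → E4) :=
    rfl
  rw [hval, _root_.Literature.Geometry.Manifold.OpenSubmanifold.mfderiv_subtype_val,
    _root_.Literature.Geometry.Manifold.OpenSubmanifold.mfderiv_subtype_val] at hc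
  rw [← ContinuousLinearMap.id_comp
    (mfderiv 𝓘(ℝ, E4) 𝓘(ℝ, E4) (TopologicalSpace.Opens.inclusion h) x)]
  exact hc.symm

/-- Chain rule along the inclusion of open subsets of `E4`: `d(Ψ ∘ ι)(x) = dΨ(ι x)` (Lee 2013, Prop. 3.9).
[folklore] -/
theorem thinnedFlatChart_mfderiv_comp_opensInclusion {U V : TopologicalSpace.Opens E4} (h : U ≤ V)
    {N : Type*} [TopologicalSpace N] [ChartedSpace E4 N] {Ψ : V → N} {x : U}
    (hΨ : MDifferentiableAt 𝓘(ℝ, E4) (𝓡 4) Ψ (TopologicalSpace.Opens.inclusion h x)) :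
    mfderiv 𝓘(ℝ, E4) (𝓡 4) (Ψ ∘ TopologicalSpace.Opens.inclusion h) x =
      mfderiv 𝓘(ℝ, E4) (𝓡 4) Ψ (TopologicalSpace.Opens.inclusion h x) := by
  -- adapted from `mfderiv_comp_opensInclusion` (private) in Literature/Geometry/Lorentzian/KerrCollarConvergence.lean
  rw [mfderiv_comp x hΨ ((contMDiff_inclusion (n := ∞) h x).mdifferentiableAt (by simp)),
    thinnedFlatChart_mfderiv_opensInclusion]
  exact ContinuousLinearMap.comp_id _

/-- **Restart of a late chart.** A late chart into `O` after `T` on a background with continuous time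
function is a late chart into `O` after any `T₁ ≥ T`: the late region `{t > T₁}` is an open subset of
`{t > T}`, so the open embedding restricts (composition with the open embedding `Set.inclusion`), and images
shrink. DHRT arXiv:2104.08222, §1. [folklore] -/
theorem thinnedFlatChart_isLateChart_of_le {𝓢 : Spacetime 4} {B : ModelBackground} {O : Set 𝓢.carrier}
    {T T₁ : ℝ} (hT : T ≤ T₁) (hB : Continuous B.time) {Ψ : B.domain → 𝓢.carrier}
    (h : 𝓢.IsLateChart B O T Ψ) : 𝓢.IsLateChart B O T₁ Ψ where
  contMDiff := h.contMDiff
  isOpenEmbedding := by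
    have hsub : B.lateRegion T₁ ⊆ B.lateRegion T := B.lateRegion_mono hT
    have hopen : IsOpen (B.lateRegion T₁) :=
      isOpen_lt continuous_const (hB.comp continuous_subtype_val)
    have hι : Topology.IsOpenEmbedding (Set.inclusion hsub) :=
      Topology.IsOpenEmbedding.inclusion hsub (hopen.preimage continuous_subtype_val)
    exact h.isOpenEmbedding.comp hι
  image_subset := (Set.image_mono (B.lateRegion_mono hT)).trans h.image_subset

/-- **H_thin — restriction and restart of late charts.** (i) Restart: `IsLateChart B' O T Ψ' → IsLateChart B' O T₁ Ψ'`
for `T ≤ T₁` when `B'.time` is continuous. (ii) Restriction of the flat chart to `U₀ ⊓ W`: a late chart after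
`T₁` with the same values, the same differential, and the same derivatives of the extended deviation at points
of `U₀ ⊓ W`. DHRT arXiv:2104.08222, §1; Lee, Smooth Manifolds, Prop. 3.9. -/
theorem stub_thinnedFlatChart : open scoped Manifold Topology in ∀ (X : Type) [TopologicalSpace X] [ChartedSpace (EuclideanSpace ℝ (Fin 3)) X] [IsManifold (𝓡 3) ((⊤ : ℕ∞) : WithTop ℕ∞) X] [T2Space X] [SecondCountableTopology X] [ConnectedSpace X], ∀ (D : Literature.Geometry.Lorentzian.InitialDataSet (𝓡 3) X) (𝒟 : Literature.Geometry.Lorentzian.VacuumCauchyDevelopment D) (O : Set 𝒟.carrier) (T T₁ : ℝ), T ≤ T₁ →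
    (∀ (B' : Literature.Geometry.Lorentzian.ModelBackground) (Ψ' : B'.domain → 𝒟.carrier), Continuous B'.time → 𝒟.toSpacetime.IsLateChart B' O T Ψ' → 𝒟.toSpacetime.IsLateChart B' O T₁ Ψ') ∧
    ∀ (U₀ W : TopologicalSpace.Opens Literature.Geometry.Lorentzian.E4) (Ψ₀ : (Literature.Geometry.Lorentzian.Minkowski.backgroundOn U₀).domain → 𝒟.carrier), 𝒟.toSpacetime.IsLateChart (Literature.Geometry.Lorentzian.Minkowski.backgroundOn U₀) O T Ψ₀ →
      ∃ Φ₀ : (Literature.Geometry.Lorentzian.Minkowski.backgroundOn (U₀ ⊓ W)).domain → 𝒟.carrier,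
        (∀ y : (Literature.Geometry.Lorentzian.Minkowski.backgroundOn (U₀ ⊓ W)).domain, Φ₀ y = Ψ₀ ⟨y.1, y.2.1⟩) ∧
        𝒟.toSpacetime.IsLateChart (Literature.Geometry.Lorentzian.Minkowski.backgroundOn (U₀ ⊓ W)) O T₁ Φ₀ ∧
        (∀ (y : (Literature.Geometry.Lorentzian.Minkowski.backgroundOn (U₀ ⊓ W)).domain) (v : Literature.Geometry.Lorentzian.E4), mfderiv 𝓘(ℝ, Literature.Geometry.Lorentzian.E4) (𝓡 4) Φ₀ y v = mfderiv 𝓘(ℝ, Literature.Geometry.Lorentzian.E4) (𝓡 4) Ψ₀ ⟨y.1, y.2.1⟩ v) ∧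
        (∀ (m : ℕ) (y : (Literature.Geometry.Lorentzian.Minkowski.backgroundOn (U₀ ⊓ W)).domain), iteratedFDeriv ℝ m (𝒟.toSpacetime.deviationExtend (Literature.Geometry.Lorentzian.Minkowski.backgroundOn (U₀ ⊓ W)) Φ₀) y.1 = iteratedFDeriv ℝ m (𝒟.toSpacetime.deviationExtend (Literature.Geometry.Lorentzian.Minkowski.backgroundOn U₀) Ψ₀) y.1) := by
  intro X _ _ _ _ _ _ D 𝒟 O T T₁ hT
  refine ⟨fun B' Ψ' hB' h ↦ thinnedFlatChart_isLateChart_of_le hT hB' h, fun U₀ W Ψ₀ hΨ₀ ↦ ?_⟩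
  have h : (Minkowski.backgroundOn (U₀ ⊓ W)).domain ≤ (Minkowski.backgroundOn U₀).domain :=
    inf_le_left
  refine ⟨Ψ₀ ∘ TopologicalSpace.Opens.inclusion h, fun _ ↦ rfl, ?_, ?_, ?_⟩
  · exact thinnedFlatChart_isLateChart_of_le hT (PiLp.continuous_apply 2 _ 0)
      (hΨ₀.comp_inclusion h fun _ ↦ rfl)
  · intro y v
    have hd := thinnedFlatChart_mfderiv_comp_opensInclusion h (Ψ := Ψ₀) (x := y)
      ((hΨ₀.contMDiff _).mdifferentiableAt (by simp))
    exact DFunLike.congr_fun hd v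
  · intro m y
    have hev : 𝒟.toSpacetime.deviationExtend (Minkowski.backgroundOn (U₀ ⊓ W))
        (Ψ₀ ∘ TopologicalSpace.Opens.inclusion h) =ᶠ[𝓝 y.1]
        𝒟.toSpacetime.deviationExtend (Minkowski.backgroundOn U₀) Ψ₀ := by
      filter_upwards [(U₀ ⊓ W).isOpen.mem_nhds y.2] with z hz
      exact 𝒟.toSpacetime.deviationExtend_comp_inclusion_of_mem h (fun _ ↦ rfl) hΨ₀.contMDiff hz
    exact (hev.iteratedFDeriv ℝ m).eq_of_nhds

end Summit.FinalStateConjecture.FinalStateConjecture.Theorems.DissipativeFinalMotions.DispersingCapture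

end
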